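import Summits.Ventures.MM22.Rank333.LowerBounds
import Literature.Computability.AlgebraicComplexity.MatMulRankLowerBoundsBlaserProofs
import HarnessLib

/-!
# MM22 venture — readings of the target `RankGe21F2` over `ℤ`, `ℤ/2ᵏ` and every two-element field (CONDITIONAL transports)

HONEST FRAMING (cell `pub-mm22`, seat LIT-2 g9). No bound is proved here. `RankGe21F2` (`21 ≤ R_{𝔽₂}(⟨3,3,3⟩)`,
`LowerBounds.lean`) is the venture's OPEN target; the cell's root object of record is an implication
(`rankGe21F2_of_lifts8`-shaped: kernel modulo per-orbit lift certificates). This file records, ONCE, what a proof of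
`RankGe21F2` gives over other coefficient rings, so that the day the target becomes a kernel theorem the readings are
one application away (and so that CONDITIONAL objects `h → RankGe21F2` transport verbatim): along any ring homomorphism
`R → ZMod 2` a bilinear scheme over `R` reduces to one over `𝔽₂` with the same number of products (Bläser 1999, §5
eq. (10), tree `tensorRank_matMulTensor_map_le`), hence

* `RankGe21F2.of_ringHom` — `(h : RankGe21F2) → 21 ≤ R_R(⟨3,3,3⟩)` for every commutative semiring `R` with `R →+* ZMod 2`;
* `RankGe21F2.int` — over `ℤ`: no `3 × 3` scheme with INTEGER coefficients and `≤ 20` products (the coefficient ring of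
  the flip-graph schemes lifted from `ℤ₂`); `RankGe21F2.window_int` — then `21 ≤ R_ℤ(⟨3,3,3⟩) ≤ 23` (Laderman);
* `RankGe21F2.zmod_two_pow` — over `ℤ/2ᵏ`, `k ≥ 1` (Hensel stages); `RankGe21F2.card_two` — every field with two elements;
* `RankGe21F2.window_F2` — `21 ≤ R_{𝔽₂}(⟨3,3,3⟩) ≤ 23`; `RankGe21F2.not_le_twenty_int` — reading.

SCOPE: exactly as for Wang's `20` (`Wang333RankTransport.lean`): nothing follows over `ℚ`, `ℝ`, `ℂ`, `𝔽₃`, … (no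
homomorphism to `𝔽₂`), where the tree's bound stays Bläser's `19` (`blaser2003_cor9_holds`).
-/

namespace Summit.Ventures.MM22

open Literature.Computability.AlgebraicComplexity

namespace RankGe21F2

/-- **Transport into `𝔽₂`** (conditional on the target): `RankGe21F2` gives `21 ≤ R_R(⟨3,3,3⟩)` for every commutative
semiring `R` with a ring homomorphism `R → ZMod 2`. [cite: Blaser1999, §5 eq. (10)] -/
theorem of_ringHom (h : RankGe21F2) {R : Type*} [CommSemiring R] (f : R →+* ZMod 2) :
    21 ≤ tensorRank (matMulTensor R 3 3 3) := by
  unfold RankGe21F2 at h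
  exact h.trans (tensorRank_matMulTensor_map_le f 3 3 3)

/-- **Over the integers** (conditional on the target): no `3 × 3` scheme with integer coefficients and `≤ 20` products.
[cite: Blaser1999, §5 eq. (10)] -/
theorem int (h : RankGe21F2) : 21 ≤ tensorRank (matMulTensor ℤ 3 3 3) :=
  h.of_ringHom (Int.castRingHom (ZMod 2))

/-- Reading: under the target, no integer `3 × 3` scheme with `20` (or fewer) products. -/
theorem not_le_twenty_int (h : RankGe21F2) : ¬ tensorRank (matMulTensor ℤ 3 3 3) ≤ 20 := by
  have := h.int
  omega

/-- **The integer window under the target**: `21 ≤ R_ℤ(⟨3,3,3⟩) ≤ 23` (Laderman 1976, proved over every commutative ring).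
[cite: Laderman1976, p. 126] -/
theorem window_int (h : RankGe21F2) :
    21 ≤ tensorRank (matMulTensor ℤ 3 3 3) ∧ tensorRank (matMulTensor ℤ 3 3 3) ≤ 23 :=
  ⟨h.int, tensorRank_matMulTensor_three_le_twentyThree ℤ⟩

/-- **Over `ℤ/2ᵏ`** (`k ≥ 1`; conditional on the target). [cite: Blaser1999, §5 eq. (10)] -/
theorem zmod_two_pow (h : RankGe21F2) {k : ℕ} (hk : 1 ≤ k) : 21 ≤ tensorRank (matMulTensor (ZMod (2 ^ k)) 3 3 3) :=
  h.of_ringHom (ZMod.castHom (dvd_pow_self 2 (by omega)) (ZMod 2))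

/-- **Over every field with two elements** (conditional on the target). [cite: Blaser1999, §5 eq. (10)] -/
theorem card_two (h : RankGe21F2) (F : Type*) [Field F] [Fintype F] (hF : Fintype.card F = 2) :
    21 ≤ tensorRank (matMulTensor F 3 3 3) :=
  h.of_ringHom ((ZMod.ringEquivOfPrime F Nat.prime_two hF).symm : F →+* ZMod 2)

/-- **The `𝔽₂` window under the target**: `21 ≤ R_{𝔽₂}(⟨3,3,3⟩) ≤ 23`. [cite: Laderman1976, p. 126] -/
theorem window_F2 (h : RankGe21F2) :
    21 ≤ tensorRank (matMulTensor (ZMod 2) 3 3 3) ∧ tensorRank (matMulTensor (ZMod 2) 3 3 3) ≤ 23 :=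
  ⟨h, tensorRank_matMulTensor_three_le_twentyThree (ZMod 2)⟩

end RankGe21F2

end Summit.Ventures.MM22
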